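import Summits.ResolutionOfSingularities.ResolutionOfSingularities.Theorems.WildQuotientsSummitReductionStubPairSsCodimThreeLemmas
import Summits.ResolutionOfSingularities.ResolutionOfSingularities.Theorems.WildQuotientsSummitReductionStubPairSsCodimThreeCodimTwo
import Summits.ResolutionOfSingularities.ResolutionOfSingularities.Theorems.WildQuotientsSummitReductionStubPairSsCodimThreeOrbit
import HarnessLib

/-!
# `WildQuotients.SummitReduction` (stmt-ResolutionOfSingularities-16324), line `FramePerfect`:
# stub `stub_pair_ssCodimThree` from the invariant `n_T` and the Claim of 3.4 for one orbit blow-up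

Route `ResolutionOfSingularities/WildQuotients`, crux `SummitReduction`; helper file of the line
skeleton `Cruxes/SummitReduction/Lines/FramePerfect.lean` (v6), stub A (`stub_pair_ssCodimThree` =
de Jong 1996, Lemma 3.2 made `G`-equivariant and quasi-split, de Jong 1997, proof of Prop. 5.11,
first paragraph). Assembly of the three sibling files: the equivariant induction on the number of
codimension-2 singular orbits (`…StubPairSsCodimThreeLemmas`), `codim(Sing X, X) ≥ 2` with the
local Noetherianity of the base (`…StubPairSsCodimThreeCodimTwo`), and the removal of one orbit by
repeated equivariant blow-ups of its closure, by induction on `n_T` (`…StubPairSsCodimThreeOrbit`).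
Result: `stub_pair_ssCodimThree_of_thickness_of_orbitBlowup` — **the registered signature of stub A,
verbatim, from the two chart-level statements of de Jong 1996, 3.3–3.4 in the quasi-split
equivariant setting**, the next layer of the stub:

* (hT) the invariant `n_T`: `2 ≤ n(x) < ∞` at every codimension-`≤ 2` singular point `x` of the
  total space of a projective quasi-split semi-stable curve over `Y` smooth over `Y ∖ D` (the tree
  proves it over an algebraically closed field, `DeJong1996SemiStableThickness_holds`);
* (hB) the Claim of 3.4 (ii)–(iii) for ONE blowing up `π : X₁ ⟶ X` of the reduced orbit closure
  `cl(G · x)` of such a point: `π ≫ f` is again semi-stable, quasi-split and smooth over `Y ∖ D`,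
  and `π` maps codimension-`≤ 2` singular points to codimension-`≤ 2` singular points,
  injectively, preserving `n` off the orbit and with `n + 2 = n(x)` over it (the tree:
  `DeJong1996SemiStableCodimTwoBlowup`, one component, algebraically closed field, resting on the
  open leaf `DeJong1996SemiStableCodimTwoBlowupFlatNodal`).
-/

set_option linter.dupNamespace false

noncomputable section

open CategoryTheory CategoryTheory.Limits AlgebraicGeometry TopologicalSpace
open Literature.AlgebraicGeometry.Resolution
open Literature.AlgebraicGeometry
open Scheme.IdealSheafData

namespace Summit.ResolutionOfSingularities.ResolutionOfSingularities.Theorems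

/-- **De Jong 1996, Lemma 3.2 made `G`-equivariant, for an abstract fibre condition `Q`** (the
two inductions assembled): over a regular locally Noetherian `G`-base `Y ⊇ D` over a field `k`,
if (h0) the codimension-`≤ 2` singular points of the total space of a projective `Q`-curve form a
finite set, (hT) they have thickness `2 ≤ n(x) < ∞`, and (hB) the Claim of 3.4 holds for one
blow-up of an orbit closure (`Q` upstairs, codimension-`≤ 2` singular points mapped injectively to
such, `n` preserved off the orbit and dropping by `2` over it), then every `G`-equivariant
projective `Q`-curve with `G`-permuted sections into the smooth locus admits a `G`-equivariant
projective modification with lifted permuted sections, the same boundary, `Q`, and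
`codim(Sing X', X') ≥ 3` — `pair_codimThree_of_finite_of_orbitModification` with (h1) supplied by
`orbitModification_of_thickness_of_orbitBlowup`. [cite: DeJong1996, 3.2–3.4 and 4.24, pp. 62–64, 75]
[cite: DeJong1997, proof of Prop. 5.11, p. 618] -/
theorem pair_codimThree_of_thickness_of_orbitBlowup {k : Type} [Field k] {Y : Scheme.{0}}
    [IsLocallyNoetherian Y] (q : Y ⟶ Spec (.of k)) (hreg : Scheme.IsRegular Y) (D : Set Y)
    {G : Type} [Group G] (ρY : G →* Aut Y) (Q : ∀ ⦃X : Scheme.{0}⦄, (X ⟶ Y) → Prop)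
    (h0 : ∀ (X : Scheme.{0}) [IsIntegral X] (f : X ⟶ Y),
      Motives.IsProjectiveOver (Over.mk (f ≫ q)) → Q f → (Scheme.singularLocusCodimLE X 2).Finite)
    (hT : ∀ (X : Scheme.{0}) [IsIntegral X] (f : X ⟶ Y),
      Motives.IsProjectiveOver (Over.mk (f ≫ q)) → Q f → ∀ x ∈ Scheme.singularLocusCodimLE X 2,
        2 ≤ Scheme.Hom.nodeThickness f x ∧ Scheme.Hom.nodeThickness f x ≠ ⊤)
    (hB : ∀ (X : Scheme.{0}) [IsIntegral X] (f : X ⟶ Y) (ρX : G →* Aut X),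
      Motives.IsProjectiveOver (Over.mk (f ≫ q)) → Q f →
      (∀ g : G, (ρX g).hom ≫ f = f ≫ (ρY g).hom) → ∀ x ∈ Scheme.singularLocusCodimLE X 2,
      ∀ (X₁ : Scheme.{0}) (π : X₁ ⟶ X),
        IsBlowup π (vanishingIdeal
          ⟨closure (Set.range fun g : G => (ρX g).hom.base x), isClosed_closure⟩) →
        Q (π ≫ f) ∧
        Set.MapsTo π.base (Scheme.singularLocusCodimLE X₁ 2) (Scheme.singularLocusCodimLE X 2) ∧
        Set.InjOn π.base (Scheme.singularLocusCodimLE X₁ 2) ∧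
        (∀ x₁ ∈ Scheme.singularLocusCodimLE X₁ 2,
          π.base x₁ ∉ Set.range (fun g : G => (ρX g).hom.base x) →
            Scheme.Hom.nodeThickness (π ≫ f) x₁ = Scheme.Hom.nodeThickness f (π.base x₁)) ∧
        (∀ x₁ ∈ Scheme.singularLocusCodimLE X₁ 2,
          π.base x₁ ∈ Set.range (fun g : G => (ρX g).hom.base x) →
            Scheme.Hom.nodeThickness (π ≫ f) x₁ + 2 = Scheme.Hom.nodeThickness f x))
    (X : Scheme.{0}) [IsIntegral X] (f : X ⟶ Y) (ρX : G →* Aut X)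
    (hproj : Motives.IsProjectiveOver (Over.mk (f ≫ q))) (hQ : Q f)
    (hρf : ∀ g : G, (ρX g).hom ≫ f = f ≫ (ρY g).hom) {m : ℕ} (τ : Fin m → (Y ⟶ X))
    (hτsm : ∀ i, ∃ U : X.Opens, Set.range (τ i) ⊆ (U : Set X) ∧ Smooth (U.ι ≫ f))
    (hτG : ∀ (g : G) (i : Fin m), ∃ j : Fin m, τ i ≫ (ρX g).hom = (ρY g).hom ≫ τ j) :
    ∃ (X' : Scheme.{0}) (_ : IsIntegral X') (φ : X' ⟶ X) (ρX' : G →* Aut X')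
      (τ' : Fin m → (Y ⟶ X')),
      IsModification φ ∧ (∀ g : G, (ρX' g).hom ≫ φ = φ ≫ (ρX g).hom) ∧ (∀ i, τ' i ≫ φ = τ i) ∧
      φ.base ⁻¹' DeJong1996.semiStableBoundary f D τ =
        DeJong1996.semiStableBoundary (φ ≫ f) D τ' ∧
      (∀ x : X', ¬ IsRegularLocalRing (X'.presheaf.stalk x) →
        (3 : WithBot ℕ∞) ≤ ringKrullDim (X'.presheaf.stalk x)) ∧
      (Motives.IsProjectiveOver (Over.mk ((φ ≫ f) ≫ q)) ∧ Q (φ ≫ f)) ∧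
      (∀ U : X.Opens, Smooth (U.ι ≫ f) → IsIso (φ ∣_ U)) ∧
      (∀ i, ∃ U : X'.Opens, Set.range (τ' i) ⊆ (U : Set X') ∧ Smooth (U.ι ≫ φ ≫ f)) ∧
      (∀ (g : G) (i : Fin m), ∃ j : Fin m, τ' i ≫ (ρX' g).hom = (ρY g).hom ≫ τ' j) :=
  pair_codimThree_of_finite_of_orbitModification D ρY
    (fun ⦃X : Scheme.{0}⦄ (f : X ⟶ Y) => Motives.IsProjectiveOver (Over.mk (f ≫ q)) ∧ Q f)
    (fun X _ f hP => h0 X f hP.1 hP.2)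
    (fun X _ f ρX hP hρf x hx =>
      orbitModification_of_thickness_of_orbitBlowup q hreg ρY Q hT hB X f ρX hP hρf x hx)
    X f ρX ⟨hproj, hQ⟩ hρf τ hτsm hτG

/-- **Stub A of the line (`stub_pair_ssCodimThree`, registered signature verbatim) from the
invariant `n_T` (hT) and the Claim of de Jong 1996, 3.4 for one blow-up of an orbit closure (hB)**,
both stated for the `G`-semi-stable pairs of the line over the fixed `G`-base `(Y ⊇ D, ρ_Y)`:
de Jong 1996, Lemma 3.2 made `G`-equivariant and quasi-split (de Jong 1997, proof of Prop. 5.11,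
¶1). Proof: `stub_pair_ssCodimThree_of_singCodimTwo_of_orbitModification` with (h0) discharged by
`two_le_ringKrullDim_of_not_isRegularLocalRing` and (h1) by
`orbitModification_of_thickness_of_orbitBlowup` (the base `Y` is locally Noetherian by
`isLocallyNoetherian_base`). [cite: DeJong1996, 3.2–3.4 and 4.24, pp. 62–64, 75]
[cite: DeJong1997, proof of Prop. 5.11, p. 618] -/
theorem stub_pair_ssCodimThree_of_thickness_of_orbitBlowup (k : Type) [Field k] (X Y : Scheme.{0})
    [IsIntegral X] [IsIntegral Y] (f : X ⟶ Y) (q : Y ⟶ Spec (.of k))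
    (hprojX : Motives.IsProjectiveOver (Over.mk (f ≫ q))) (hreg : Scheme.IsRegular Y)
    (D : Set Y) (hD : IsStrictNormalCrossingsDivisor Y D)
    (G : Type) [Group G] [Finite G] (ρX : G →* Aut X) (ρY : G →* Aut Y)
    (hρf : (∀ g : G, (ρX g).hom ≫ f = f ≫ (ρY g).hom))
    (_hDG : (∀ g : G, (ρY g).hom.base '' D = D))
    (_hDstrict : (∀ (g : G) (C : Set Y), Maximal (fun C : Set Y => IsIrreducible C ∧ C ⊆ D) C →
        (C ∩ (ρY g).hom.base '' C).Nonempty → (ρY g).hom.base '' C = C))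
    (hss : IsSemiStableCurve f)
    (hqs : (∀ x : X, (¬ ∃ U : X.Opens, x ∈ U ∧ Smooth (U.ι ≫ f)) →
        ∃ e : AdicCompletion
            ((IsLocalRing.maximalIdeal (X.presheaf.stalk x)).map (Ideal.Quotient.mk
              ((IsLocalRing.maximalIdeal (Y.presheaf.stalk (f.base x))).map (f.stalkMap x).hom)))
            (X.presheaf.stalk x ⧸
              (IsLocalRing.maximalIdeal (Y.presheaf.stalk (f.base x))).map (f.stalkMap x).hom) ≃+*
          MvPowerSeries (Fin 2) (Y.presheaf.stalk (f.base x) ⧸ IsLocalRing.maximalIdeal (Y.presheaf.stalk (f.base x))) ⧸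
            Ideal.span {(MvPowerSeries.X 0 * MvPowerSeries.X 1 :
              MvPowerSeries (Fin 2) (Y.presheaf.stalk (f.base x) ⧸ IsLocalRing.maximalIdeal (Y.presheaf.stalk (f.base x))))},
          e.toRingHom.comp ((algebraMap (X.presheaf.stalk x ⧸
              (IsLocalRing.maximalIdeal (Y.presheaf.stalk (f.base x))).map (f.stalkMap x).hom) _).comp
            (Ideal.quotientMap ((IsLocalRing.maximalIdeal (Y.presheaf.stalk (f.base x))).map (f.stalkMap x).hom)
              (f.stalkMap x).hom Ideal.le_comap_map)) =
          algebraMap (Y.presheaf.stalk (f.base x) ⧸ IsLocalRing.maximalIdeal (Y.presheaf.stalk (f.base x))) _))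
    (hsm : Smooth (f ∣_ ⟨Dᶜ, hD.isClosed.isOpen_compl⟩))
    (m : ℕ) (τ : Fin m → (Y ⟶ X)) (_hτf : (∀ i : Fin m, τ i ≫ f = 𝟙 Y))
    (_hτdisj : (Pairwise fun i j : Fin m => Disjoint (Set.range (τ i)) (Set.range (τ j))))
    (hτsm : (∀ i : Fin m, ∃ U : X.Opens, Set.range (τ i) ⊆ (U : Set X) ∧ Smooth (U.ι ≫ f)))
    (hτG : (∀ (g : G) (i : Fin m), ∃ j : Fin m, τ i ≫ (ρX g).hom = (ρY g).hom ≫ τ j))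
    (hT : ∀ (X : Scheme.{0}) [IsIntegral X] (f : X ⟶ Y),
      Motives.IsProjectiveOver (Over.mk (f ≫ q)) → IsSemiStableCurve f →
      (∀ x : X, (¬ ∃ U : X.Opens, x ∈ U ∧ Smooth (U.ι ≫ f)) →
          ∃ e : AdicCompletion
              ((IsLocalRing.maximalIdeal (X.presheaf.stalk x)).map (Ideal.Quotient.mk
                ((IsLocalRing.maximalIdeal (Y.presheaf.stalk (f.base x))).map (f.stalkMap x).hom)))
              (X.presheaf.stalk x ⧸
                (IsLocalRing.maximalIdeal (Y.presheaf.stalk (f.base x))).map (f.stalkMap x).hom) ≃+*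
            MvPowerSeries (Fin 2) (Y.presheaf.stalk (f.base x) ⧸ IsLocalRing.maximalIdeal (Y.presheaf.stalk (f.base x))) ⧸
              Ideal.span {(MvPowerSeries.X 0 * MvPowerSeries.X 1 :
                MvPowerSeries (Fin 2) (Y.presheaf.stalk (f.base x) ⧸ IsLocalRing.maximalIdeal (Y.presheaf.stalk (f.base x))))},
            e.toRingHom.comp ((algebraMap (X.presheaf.stalk x ⧸
                (IsLocalRing.maximalIdeal (Y.presheaf.stalk (f.base x))).map (f.stalkMap x).hom) _).comp
              (Ideal.quotientMap ((IsLocalRing.maximalIdeal (Y.presheaf.stalk (f.base x))).map (f.stalkMap x).hom)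
                (f.stalkMap x).hom Ideal.le_comap_map)) =
            algebraMap (Y.presheaf.stalk (f.base x) ⧸ IsLocalRing.maximalIdeal (Y.presheaf.stalk (f.base x))) _) →
      Smooth (f ∣_ ⟨Dᶜ, hD.isClosed.isOpen_compl⟩) →
      ∀ x ∈ Scheme.singularLocusCodimLE X 2,
        2 ≤ Scheme.Hom.nodeThickness f x ∧ Scheme.Hom.nodeThickness f x ≠ ⊤)
    (hB : ∀ (X : Scheme.{0}) [IsIntegral X] (f : X ⟶ Y) (ρX : G →* Aut X),
      Motives.IsProjectiveOver (Over.mk (f ≫ q)) →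
      (∀ g : G, (ρX g).hom ≫ f = f ≫ (ρY g).hom) → IsSemiStableCurve f →
      (∀ x : X, (¬ ∃ U : X.Opens, x ∈ U ∧ Smooth (U.ι ≫ f)) →
          ∃ e : AdicCompletion
              ((IsLocalRing.maximalIdeal (X.presheaf.stalk x)).map (Ideal.Quotient.mk
                ((IsLocalRing.maximalIdeal (Y.presheaf.stalk (f.base x))).map (f.stalkMap x).hom)))
              (X.presheaf.stalk x ⧸
                (IsLocalRing.maximalIdeal (Y.presheaf.stalk (f.base x))).map (f.stalkMap x).hom) ≃+*
            MvPowerSeries (Fin 2) (Y.presheaf.stalk (f.base x) ⧸ IsLocalRing.maximalIdeal (Y.presheaf.stalk (f.base x))) ⧸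
              Ideal.span {(MvPowerSeries.X 0 * MvPowerSeries.X 1 :
                MvPowerSeries (Fin 2) (Y.presheaf.stalk (f.base x) ⧸ IsLocalRing.maximalIdeal (Y.presheaf.stalk (f.base x))))},
            e.toRingHom.comp ((algebraMap (X.presheaf.stalk x ⧸
                (IsLocalRing.maximalIdeal (Y.presheaf.stalk (f.base x))).map (f.stalkMap x).hom) _).comp
              (Ideal.quotientMap ((IsLocalRing.maximalIdeal (Y.presheaf.stalk (f.base x))).map (f.stalkMap x).hom)
                (f.stalkMap x).hom Ideal.le_comap_map)) =
            algebraMap (Y.presheaf.stalk (f.base x) ⧸ IsLocalRing.maximalIdeal (Y.presheaf.stalk (f.base x))) _) →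
      Smooth (f ∣_ ⟨Dᶜ, hD.isClosed.isOpen_compl⟩) →
      ∀ x ∈ Scheme.singularLocusCodimLE X 2, ∀ (X₁ : Scheme.{0}) (π : X₁ ⟶ X),
        IsBlowup π (vanishingIdeal
          ⟨closure (Set.range fun g : G => (ρX g).hom.base x), isClosed_closure⟩) →
        IsSemiStableCurve (π ≫ f) ∧
        (∀ x : X₁, (¬ ∃ U : X₁.Opens, x ∈ U ∧ Smooth (U.ι ≫ (π ≫ f))) →
            ∃ e : AdicCompletion
                ((IsLocalRing.maximalIdeal (X₁.presheaf.stalk x)).map (Ideal.Quotient.mk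
                  ((IsLocalRing.maximalIdeal (Y.presheaf.stalk ((π ≫ f).base x))).map ((π ≫ f).stalkMap x).hom)))
                (X₁.presheaf.stalk x ⧸
                  (IsLocalRing.maximalIdeal (Y.presheaf.stalk ((π ≫ f).base x))).map ((π ≫ f).stalkMap x).hom) ≃+*
              MvPowerSeries (Fin 2) (Y.presheaf.stalk ((π ≫ f).base x) ⧸ IsLocalRing.maximalIdeal (Y.presheaf.stalk ((π ≫ f).base x))) ⧸
                Ideal.span {(MvPowerSeries.X 0 * MvPowerSeries.X 1 :
                  MvPowerSeries (Fin 2) (Y.presheaf.stalk ((π ≫ f).base x) ⧸ IsLocalRing.maximalIdeal (Y.presheaf.stalk ((π ≫ f).base x))))},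
              e.toRingHom.comp ((algebraMap (X₁.presheaf.stalk x ⧸
                  (IsLocalRing.maximalIdeal (Y.presheaf.stalk ((π ≫ f).base x))).map ((π ≫ f).stalkMap x).hom) _).comp
                (Ideal.quotientMap ((IsLocalRing.maximalIdeal (Y.presheaf.stalk ((π ≫ f).base x))).map ((π ≫ f).stalkMap x).hom)
                  ((π ≫ f).stalkMap x).hom Ideal.le_comap_map)) =
              algebraMap (Y.presheaf.stalk ((π ≫ f).base x) ⧸ IsLocalRing.maximalIdeal (Y.presheaf.stalk ((π ≫ f).base x))) _) ∧
        Smooth ((π ≫ f) ∣_ ⟨Dᶜ, hD.isClosed.isOpen_compl⟩) ∧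
        Set.MapsTo π.base (Scheme.singularLocusCodimLE X₁ 2) (Scheme.singularLocusCodimLE X 2) ∧
        Set.InjOn π.base (Scheme.singularLocusCodimLE X₁ 2) ∧
        (∀ x₁ ∈ Scheme.singularLocusCodimLE X₁ 2,
          π.base x₁ ∉ Set.range (fun g : G => (ρX g).hom.base x) →
            Scheme.Hom.nodeThickness (π ≫ f) x₁ = Scheme.Hom.nodeThickness f (π.base x₁)) ∧
        (∀ x₁ ∈ Scheme.singularLocusCodimLE X₁ 2,
          π.base x₁ ∈ Set.range (fun g : G => (ρX g).hom.base x) →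
            Scheme.Hom.nodeThickness (π ≫ f) x₁ + 2 = Scheme.Hom.nodeThickness f x)) :
    ∃ (X' : Scheme.{0}) (_ : IsIntegral X') (φ : X' ⟶ X) (ρX' : G →* Aut X')
          (τ' : Fin m → (Y ⟶ X')),
          IsModification φ ∧ (∀ g : G, (ρX' g).hom ≫ φ = φ ≫ (ρX g).hom) ∧ (∀ i : Fin m, τ' i ≫ φ = τ i) ∧
          φ.base ⁻¹' DeJong1996.semiStableBoundary f D τ = DeJong1996.semiStableBoundary (φ ≫ f) D τ' ∧
          (∀ x : X', ¬ IsRegularLocalRing (X'.presheaf.stalk x) →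
              (3 : WithBot ℕ∞) ≤ ringKrullDim (X'.presheaf.stalk x)) ∧
          Motives.IsProjectiveOver (Over.mk ((φ ≫ f) ≫ q)) ∧
          IsSemiStableCurve (φ ≫ f) ∧
          (∀ x : X', (¬ ∃ U : X'.Opens, x ∈ U ∧ Smooth (U.ι ≫ (φ ≫ f))) →
              ∃ e : AdicCompletion
                  ((IsLocalRing.maximalIdeal (X'.presheaf.stalk x)).map (Ideal.Quotient.mk
                    ((IsLocalRing.maximalIdeal (Y.presheaf.stalk ((φ ≫ f).base x))).map ((φ ≫ f).stalkMap x).hom)))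
                  (X'.presheaf.stalk x ⧸
                    (IsLocalRing.maximalIdeal (Y.presheaf.stalk ((φ ≫ f).base x))).map ((φ ≫ f).stalkMap x).hom) ≃+*
                MvPowerSeries (Fin 2) (Y.presheaf.stalk ((φ ≫ f).base x) ⧸ IsLocalRing.maximalIdeal (Y.presheaf.stalk ((φ ≫ f).base x))) ⧸
                  Ideal.span {(MvPowerSeries.X 0 * MvPowerSeries.X 1 :
                    MvPowerSeries (Fin 2) (Y.presheaf.stalk ((φ ≫ f).base x) ⧸ IsLocalRing.maximalIdeal (Y.presheaf.stalk ((φ ≫ f).base x))))},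
                e.toRingHom.comp ((algebraMap (X'.presheaf.stalk x ⧸
                    (IsLocalRing.maximalIdeal (Y.presheaf.stalk ((φ ≫ f).base x))).map ((φ ≫ f).stalkMap x).hom) _).comp
                  (Ideal.quotientMap ((IsLocalRing.maximalIdeal (Y.presheaf.stalk ((φ ≫ f).base x))).map ((φ ≫ f).stalkMap x).hom)
                    ((φ ≫ f).stalkMap x).hom Ideal.le_comap_map)) =
                algebraMap (Y.presheaf.stalk ((φ ≫ f).base x) ⧸ IsLocalRing.maximalIdeal (Y.presheaf.stalk ((φ ≫ f).base x))) _) ∧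
          Smooth ((φ ≫ f) ∣_ ⟨Dᶜ, hD.isClosed.isOpen_compl⟩) ∧
          (∀ i : Fin m, ∃ U : X'.Opens, Set.range (τ' i) ⊆ (U : Set X') ∧ Smooth (U.ι ≫ (φ ≫ f))) ∧
          (∀ (g : G) (i : Fin m), ∃ j : Fin m, τ' i ≫ (ρX' g).hom = (ρY g).hom ≫ τ' j) := by
  haveI := DeJong1996.isNoetherian_of_isProjectiveOver (f ≫ q) hprojX
  haveI : IsLocallyNoetherian Y := isLocallyNoetherian_base hss
  refine stub_pair_ssCodimThree_of_singCodimTwo_of_orbitModification k Y q D hD G ρY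
    (fun X _ f hproj hss hsm x hx =>
      two_le_ringKrullDim_of_not_isRegularLocalRing k f q hproj hreg D hD hss hsm x hx)
    (fun X _ f ρX hproj hρf hss hqs hsm x hx₁ hx₂ => ?_)
    X f hprojX ρX hρf hss hqs hsm m τ hτsm hτG
  obtain ⟨X', hX', φ, ρX', hφ, hequiv, ⟨hproj', hss', hqs', hsm'⟩, hiso, hmaps, hinj⟩ :=
    orbitModification_of_thickness_of_orbitBlowup q hreg ρY
      (fun ⦃X : Scheme.{0}⦄ (f : X ⟶ Y) => IsSemiStableCurve f ∧
        (∀ x : X, (¬ ∃ U : X.Opens, x ∈ U ∧ Smooth (U.ι ≫ f)) →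
            ∃ e : AdicCompletion
                ((IsLocalRing.maximalIdeal (X.presheaf.stalk x)).map (Ideal.Quotient.mk
                  ((IsLocalRing.maximalIdeal (Y.presheaf.stalk (f.base x))).map (f.stalkMap x).hom)))
                (X.presheaf.stalk x ⧸
                  (IsLocalRing.maximalIdeal (Y.presheaf.stalk (f.base x))).map (f.stalkMap x).hom) ≃+*
              MvPowerSeries (Fin 2) (Y.presheaf.stalk (f.base x) ⧸ IsLocalRing.maximalIdeal (Y.presheaf.stalk (f.base x))) ⧸
                Ideal.span {(MvPowerSeries.X 0 * MvPowerSeries.X 1 :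
                  MvPowerSeries (Fin 2) (Y.presheaf.stalk (f.base x) ⧸ IsLocalRing.maximalIdeal (Y.presheaf.stalk (f.base x))))},
              e.toRingHom.comp ((algebraMap (X.presheaf.stalk x ⧸
                  (IsLocalRing.maximalIdeal (Y.presheaf.stalk (f.base x))).map (f.stalkMap x).hom) _).comp
                (Ideal.quotientMap ((IsLocalRing.maximalIdeal (Y.presheaf.stalk (f.base x))).map (f.stalkMap x).hom)
                  (f.stalkMap x).hom Ideal.le_comap_map)) =
              algebraMap (Y.presheaf.stalk (f.base x) ⧸ IsLocalRing.maximalIdeal (Y.presheaf.stalk (f.base x))) _) ∧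
        Smooth (f ∣_ ⟨Dᶜ, hD.isClosed.isOpen_compl⟩))
      (fun X _ f hproj hQ x hx => hT X f hproj hQ.1 hQ.2.1 hQ.2.2 x hx)
      (fun X _ f ρX hproj hQ hρf x hx X₁ π hπ => by
        obtain ⟨hss₁, hqs₁, hsm₁, hmaps, hinj, hsame, hdrop⟩ :=
          hB X f ρX hproj hρf hQ.1 hQ.2.1 hQ.2.2 x hx X₁ π hπ
        exact ⟨⟨hss₁, hqs₁, hsm₁⟩, hmaps, hinj, hsame, hdrop⟩)
      X f ρX (by exact ⟨hproj, hss, hqs, hsm⟩) hρf x ⟨hx₁, hx₂⟩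
  exact ⟨X', hX', φ, ρX', hφ, hequiv, hproj', hiso, hss', hqs', hsm', hmaps, hinj⟩

end Summit.ResolutionOfSingularities.ResolutionOfSingularities.Theorems

end
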